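import Summits.BirchSwinnertonDyer.BirchSwinnertonDyer.Theorems.BiquadraticEisensteinDescentManinDatumSupercuspidalCMInertOfPlainOddInstances
import Summits.BirchSwinnertonDyer.BirchSwinnertonDyer.Theorems.BiquadraticEisensteinDescentManinDatumSupercuspidalCMInertPlainOddOfKato
import HarnessLib

/-!
# Skeleton PROPOSAL `plain_odd_57` (v2) for crux `ManinDatumSupercuspidalCMInert` (stmt-BirchSwinnertonDyer-20111, BED r605)
# — NOT REGISTERED (width seat `bsd-wall-cm-bed-w4` g10; registration is the LEAD's / pen's call)

The registered skeleton `Lines/birth.lean` (9438078f) has stubs `stub_S5` / `stub_S7`; both are CLOSED MODULO the XL named fact F″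
(`…OfKato`, p596084) and, since 2026-08-28 (this seat, p634975), CLOSED MODULO the two PLAIN ODD CM statements H₅ / H₇
(`…OfPlainOddInstances.stub_S5_of_plainOddInstances` / `stub_S7_of_plainOddInstances`), with F″ ⟹ H₅ ∧ H₇ kernel-checked (`…PlainOddOfKato`,
p634978). This file is the corresponding v2 skeleton: stubs := {`stub_plainOddFiveSextic` (= H₅), `stub_plainOddSevenQuartic` (= H₇)}, the old
stubs `stub_S5` / `stub_S7` become THEOREMS modulo the new ones, and `ManinDatumSupercuspidalCMInert_of` concludes the ROUTE DECL BY NAME.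
Dominance (`…_of_kato`) shows v2 is never worse than «closed modulo F″». Sizing of the new stubs: classical CM twisted-`L`-value
integrality (no open mathematics) but XL to formalise here — see `Cruxes/ManinDatumSupercuspidalCMInert/PLAIN-ODD-57-w4g10.md` §3 (the one
missing brick is the Galois action on CM torsion values / tame structure of `ℚ₇(i)(E₀[7])`; the generic resolvent count is in the tree:
`…TameResolvent.resolvent_valuation_le`). 2 sorries, both in `stub_*`. BSD is not proved by any of this; nothing here closes the item.
-/

set_option linter.dupNamespace false
set_option autoImplicit false

noncomputable section

open scoped Classical

open WeierstrassCurve Literature.NumberTheory.EllipticCurves Literature.NumberTheory.EllipticCurves.ModularForms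
  Literature.NumberTheory.EllipticCurves.Rank1Residual CongruenceSubgroup

namespace Summit.BirchSwinnertonDyer.BirchSwinnertonDyer.Cruxes.ManinDatumSupercuspidalCMInert.PlainOdd57

open Summit.BirchSwinnertonDyer.BirchSwinnertonDyer.Theses.BiquadraticEisensteinDescent
open Summit.BirchSwinnertonDyer.BirchSwinnertonDyer.Theorems.BiquadraticEisensteinDescentManinDatumSupercuspidalCMInertOfPlainOddInstances
  (stub_S5_of_plainOddInstances stub_S7_of_plainOddInstances maninDatumSupercuspidalCMInert_of_plainOddInstances)
open Summit.BirchSwinnertonDyer.BirchSwinnertonDyer.Theorems.BiquadraticEisensteinDescentManinDatumSupercuspidalCMInertPlainOddOfKato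
  (plainOddFive_of_kato plainOddSeven_of_kato)

/-- H₅ — the `ℤ[ω]` sextic CM statement: plain `5`-integrality in Néron units of the odd twisted symbol sums of the conductor-level newform
of every globally minimal `V` with `j = 0` bad at `5`, prime moduli `ℓ ∤ N_V`, `ℓ ≡ 19 (mod 20)`. [cite: Kato2004Asterisque, Thm. 9.7 (p. 189)]
[cite: IrelandRosen1990, Ch. 18 §7] -/
def PlainOddFiveSextic : Prop :=
  ∀ (V : WeierstrassCurve ℚ) [V.IsElliptic] [V.IsGloballyMinimal] [NeZero (V.conductorNorm ℤ)],
    V.j = 0 → ¬ V.HasGoodReductionAtPrime 5 →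
    ∀ (f : CuspForm (CongruenceSubgroup.Gamma0 (V.conductorNorm ℤ)) 2), IsNewformOf V f →
    ∀ (ℓ : ℕ) [NeZero ℓ], ℓ.Prime → ¬ ℓ ∣ V.conductorNorm ℤ → ℓ % 20 = 19 →
    ∀ χ : DirichletCharacter ℂ ℓ, χ.Odd →
    ∀ (ϖ : ℚ) (r : ℂ), (ϖ : ℝ) * V.imaginaryPeriodRat = minusPeriod f →
      twistedSymbolSum f χ = r * (minusPeriod f : ℂ) * Complex.I →
      ∃ s : ℕ, ¬ 5 ∣ s ∧ IsIntegral ℤ ((s : ℂ) * ϖ * r)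

/-- H₇ — the `ℤ[i]` quartic CM statement: the same at `7` for `j = 1728`, `ℓ ≡ 47, 59, 83 (mod 84)` (the `p = 7` twin of crux
`InertBadAtThree`'s proved `stub_plainOddNeronIntegralThreeQuartic`). [cite: Kato2004Asterisque, Thm. 9.7 (p. 189)] [cite: IrelandRosen1990, Ch. 18 §4] -/
def PlainOddSevenQuartic : Prop :=
  ∀ (V : WeierstrassCurve ℚ) [V.IsElliptic] [V.IsGloballyMinimal] [NeZero (V.conductorNorm ℤ)],
    V.j = 1728 → ¬ V.HasGoodReductionAtPrime 7 →
    ∀ (f : CuspForm (CongruenceSubgroup.Gamma0 (V.conductorNorm ℤ)) 2), IsNewformOf V f →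
    ∀ (ℓ : ℕ) [NeZero ℓ], ℓ.Prime → ¬ ℓ ∣ V.conductorNorm ℤ → (ℓ % 84 = 47 ∨ ℓ % 84 = 59 ∨ ℓ % 84 = 83) →
    ∀ χ : DirichletCharacter ℂ ℓ, χ.Odd →
    ∀ (ϖ : ℚ) (r : ℂ), (ϖ : ℝ) * V.imaginaryPeriodRat = minusPeriod f →
      twistedSymbolSum f χ = r * (minusPeriod f : ℂ) * Complex.I →
      ∃ s : ℕ, ¬ 7 ∣ s ∧ IsIntegral ℤ ((s : ℂ) * ϖ * r)

/-! ## Stubs (2 sorries) — bodies INLINE (tree constants only) so that a `Theorems/` closer can state the identical signature -/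

/-- STUB (p = 5 cell, 268 pairs N < 5·10⁵): H₅. Size XL as a formalisation (classical CM over `ℤ[ω]`; memo PLAIN-ODD-57 §3). -/
theorem stub_plainOddFiveSextic :
    ∀ (V : WeierstrassCurve ℚ) [V.IsElliptic] [V.IsGloballyMinimal] [NeZero (V.conductorNorm ℤ)],
      V.j = 0 → ¬ V.HasGoodReductionAtPrime 5 →
      ∀ (f : CuspForm (CongruenceSubgroup.Gamma0 (V.conductorNorm ℤ)) 2), IsNewformOf V f →
      ∀ (ℓ : ℕ) [NeZero ℓ], ℓ.Prime → ¬ ℓ ∣ V.conductorNorm ℤ → ℓ % 20 = 19 →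
      ∀ χ : DirichletCharacter ℂ ℓ, χ.Odd →
      ∀ (ϖ : ℚ) (r : ℂ), (ϖ : ℝ) * V.imaginaryPeriodRat = minusPeriod f →
        twistedSymbolSum f χ = r * (minusPeriod f : ℂ) * Complex.I →
        ∃ s : ℕ, ¬ 5 ∣ s ∧ IsIntegral ℤ ((s : ℂ) * ϖ * r) := by
  sorry

/-- STUB (p = 7 cell, 48 pairs N < 5·10⁵): H₇. Size XL as a formalisation (classical CM over `ℤ[i]`; memo PLAIN-ODD-57 §3). -/
theorem stub_plainOddSevenQuartic :
    ∀ (V : WeierstrassCurve ℚ) [V.IsElliptic] [V.IsGloballyMinimal] [NeZero (V.conductorNorm ℤ)],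
      V.j = 1728 → ¬ V.HasGoodReductionAtPrime 7 →
      ∀ (f : CuspForm (CongruenceSubgroup.Gamma0 (V.conductorNorm ℤ)) 2), IsNewformOf V f →
      ∀ (ℓ : ℕ) [NeZero ℓ], ℓ.Prime → ¬ ℓ ∣ V.conductorNorm ℤ → (ℓ % 84 = 47 ∨ ℓ % 84 = 59 ∨ ℓ % 84 = 83) →
      ∀ χ : DirichletCharacter ℂ ℓ, χ.Odd →
      ∀ (ϖ : ℚ) (r : ℂ), (ϖ : ℝ) * V.imaginaryPeriodRat = minusPeriod f →
        twistedSymbolSum f χ = r * (minusPeriod f : ℂ) * Complex.I →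
        ∃ s : ℕ, ¬ 7 ∣ s ∧ IsIntegral ℤ ((s : ℂ) * ϖ * r) := by
  sorry

/-! ## The old stubs are theorems modulo the new ones (closers p634975, by name) -/

/-- `stub_S5` of skeleton 9438078f (registered signature VERBATIM) from H₅. -/
theorem stub_S5 :
    ∀ (W : WeierstrassCurve ℚ) [W.IsElliptic] [W.IsGloballyMinimal] [NeZero (W.conductorNorm ℤ)] (p : ℕ)
      [Fact p.Prime] (D : ModularParametrizationData W (W.conductorNorm ℤ)) (v : IsDedekindDomain.HeightOneSpectrum ℤ),
      Rat.HeightOneSpectrum.natGenerator v = p → W.HasCM → W.analyticRank = 1 → p = 5 → W.j = 0 →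
      CMInert W p → ¬ Good W p → (∀ z ∈ D.L.lattice, ∃ w ∈ periodLattice D.f, z = D.c * w) →
      (W.kodairaSymbolAt v = .II ∨ W.kodairaSymbolAt v = .IV ∨ W.kodairaSymbolAt v = .IVstar ∨
        W.kodairaSymbolAt v = .IIstar) → ¬ (p : ℤ) ∣ D.c :=
  stub_S5_of_plainOddInstances stub_plainOddFiveSextic

/-- `stub_S7` of skeleton 9438078f (registered signature VERBATIM) from H₇. -/
theorem stub_S7 :
    ∀ (W : WeierstrassCurve ℚ) [W.IsElliptic] [W.IsGloballyMinimal] [NeZero (W.conductorNorm ℤ)] (p : ℕ)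
      [Fact p.Prime] (D : ModularParametrizationData W (W.conductorNorm ℤ)) (v : IsDedekindDomain.HeightOneSpectrum ℤ),
      Rat.HeightOneSpectrum.natGenerator v = p → W.HasCM → W.analyticRank = 1 → p = 7 → W.j = 1728 →
      CMInert W p → ¬ Good W p → (∀ z ∈ D.L.lattice, ∃ w ∈ periodLattice D.f, z = D.c * w) →
      (W.kodairaSymbolAt v = .III ∨ W.kodairaSymbolAt v = .IIIstar) → ¬ (p : ℤ) ∣ D.c :=
  stub_S7_of_plainOddInstances stub_plainOddSevenQuartic

/-! ## Composition and dominance -/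

/-- **The crux BY NAME from the two new stubs.** -/
theorem ManinDatumSupercuspidalCMInert_of : PlainOddFiveSextic → PlainOddSevenQuartic → ManinDatumSupercuspidalCMInert :=
  fun h5 h7 ↦ maninDatumSupercuspidalCMInert_of_plainOddInstances h5 h7

/-- The composition from the stubs (kernel-checked modulo the two `sorry`s). -/
theorem ManinDatumSupercuspidalCMInert_proof : ManinDatumSupercuspidalCMInert :=
  ManinDatumSupercuspidalCMInert_of stub_plainOddFiveSextic stub_plainOddSevenQuartic

/-- DOMINANCE: the old residual F″ (Kato's fact) implies both new stubs, so v2 is never worse than «closed modulo F″» (p634978).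
[cite: Kato2004Asterisque, Thm. 9.7 (p. 189)] -/
theorem stubs_of_kato (hK : kato_neron_isIntegral_twistedSymbolSum_of_additive_five_le) :
    PlainOddFiveSextic ∧ PlainOddSevenQuartic :=
  ⟨plainOddFive_of_kato hK, plainOddSeven_of_kato hK⟩

end Summit.BirchSwinnertonDyer.BirchSwinnertonDyer.Cruxes.ManinDatumSupercuspidalCMInert.PlainOdd57

end
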